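import Summits.CriticalPhenomena.CardyFormulaZ2.Theses.CardyFlipRusso
import Summits.CriticalPhenomena.CardyFormulaZ2.Theorems.CardyFlipRussoQuadrupoleSelectionRuleBitsLegTransfer

/-!
# Lead's TYPING DRAFT no. 2 for the informal crux `QuadrupoleSelectionRule`
(stmt-CriticalPhenomena-7029): the kernel on the BITS LEG L5, in consumed form

Not a route item: a CHECKED Lean rendering of the refined typing recommendation of
`Lines/Sketch.md` (generation 2/3): type the kernel crux per leg type in the form the leg consumes.
For the product-of-bits leg L5 of `SquareFromVoronoiHub` (rotated square grid `Λ` = the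
centre-to-corner edges of the centred square lattice `ℤ² ∪ (ℤ² + (½,½))`, every face carrying ONE
of its two diagonals — the `ℤ²`-edge `BD` with probability `t`, the dual edge `AC` otherwise —
ending at `t = 1` in the route's graph `G_s`) the annealed flip–Russo formula is LANDED
(`hasDerivWithinAt_annealed_flipLeg`), so the consumed form of the kernel is simply

  `QuadrupoleSelectionRuleBitsDraft`:  for every conformal rectangle `R` there is `η → 0` with
  `|Σ_{k ∈ faces R δ} E_t[Δ_k^δ]| ≤ η δ` for all `t ∈ [0, 1]`, `0 < δ < 1`,

`Δ_k^δ = flipResponse (Γ^δ (τ \ {k})) (A k) (B k) (C k) (D k) (U_R^δ) ½` the flip response of face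
`k` for the route's crude crossing event `U_R^δ` of `R` at mesh `δ`.  The theorem
`legL5_uniform_close_of_draft` checks that this draft is consumed exactly where the kernel is
consumed on L5: it yields uniform closeness of the annealed crossing probabilities along the whole
leg (`uniform_close_annealed_flipLeg_of_kernel_bound`, landed), hence Cardy at `t = 1` (`G_s`)
from Cardy at `t = ½` (uniform random diagonals, the endpoint of L4) by an `ε/2` argument.
Everything here is definitional bookkeeping on `ℤ²` coordinates; the one combinatorial lemma is
`gamma_insert_eq_flipGraph` (switching the bit of face `k` IS the diagonal flip at `k`).

Why this leg first (lead's census): on L5 nothing about derivatives is missing; on the Poisson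
legs the perturbation formula is landed too (`uniform_close_poissonLeg_of_kernel_bound`); on the
Gaussian-jitter leg L1 (draft no. 1, `SketchTypingDraft.lean`) the Russo/coarea formula is NOT in
reach (geometric measure theory absent from Mathlib).
-/

noncomputable section

open MeasureTheory Filter Topology Set
open scoped BigOperators

namespace Summit.CriticalPhenomena.CardyFormulaZ2.Cruxes.QuadrupoleSelectionRule.TypingDraftBits

open Literature.Probability.LatticeModels Literature.Probability.Percolation
  Literature.Probability.RandomPlanarGeometry

/-! ### The centred square lattice, its faces and diagonals -/

/-- Vertices: `ℤ²` (left summand) and the dual points `ℤ² + (½, ½)` (right summand), as in the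
route's `Target`/`SquareFromVoronoiHub`/`CoveringLeg`. -/
abbrev V : Type := (ℤ × ℤ) ⊕ (ℤ × ℤ)

/-- The embedding of the route: `inl x ↦ x`, `inr f ↦ f + (½, ½)`. -/
def z : V → ℂ :=
  Sum.elim (fun x ↦ (x.1 : ℂ) + (x.2 : ℂ) * Complex.I)
    (fun f ↦ ((f.1 : ℂ) + 1 / 2) + ((f.2 : ℂ) + 1 / 2) * Complex.I)

/-- Faces of the rotated grid `Λ`, indexed by their `ℤ²`-diagonal: `(x, false)` is the face whose
`ℤ²`-diagonal is the horizontal edge `x — x + (1,0)`, `(x, true)` the one with the vertical edge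
`x — x + (0,1)`. -/
abbrev Face : Type := (ℤ × ℤ) × Bool

/-- Corner `B k`: the `ℤ²`-endpoint `x` of the `ℤ²`-diagonal of face `k`. -/
def fB (k : Face) : V := Sum.inl k.1

/-- Corner `D k`: the other `ℤ²`-endpoint (`x + (1,0)` resp. `x + (0,1)`). -/
def fD (k : Face) : V := Sum.inl (if k.2 then (k.1.1, k.1.2 + 1) else (k.1.1 + 1, k.1.2))

/-- Corner `A k`: the dual endpoint `x + (½, ½)` of the dual diagonal of face `k`. -/
def fA (k : Face) : V := Sum.inr k.1

/-- Corner `C k`: the other dual endpoint (`x + (½, −½)` resp. `x + (−½, ½)`). -/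
def fC (k : Face) : V := Sum.inr (if k.2 then (k.1.1 - 1, k.1.2) else (k.1.1, k.1.2 - 1))

/-- The rotated square grid `Λ` (centre-to-corner edges of the centred square lattice): `inl x`
is joined to the four dual points at distance `1/√2`. -/
def lamRel : V → V → Prop
  | Sum.inl x, Sum.inr f => (f.1 = x.1 ∨ f.1 = x.1 - 1) ∧ (f.2 = x.2 ∨ f.2 = x.2 - 1)
  | _, _ => False

/-- `lamRel` only relates a left vertex to a right vertex. -/
theorem isLeft_of_lamRel {u v : V} (h : lamRel u v) : u.isLeft = true := by
  cases u <;> cases v <;> simp [lamRel] at h ⊢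

/-- An edge with a left endpoint is not a dual diagonal `A k C k`. -/
theorem ne_AC_of_isLeft {u v : V} (h : u.isLeft = true ∨ v.isLeft = true) (k : Face) :
    s(u, v) ≠ s(fA k, fC k) := by
  intro heq
  rcases Sym2.eq_iff.1 heq with ⟨h1, h2⟩ | ⟨h1, h2⟩ <;>
    rcases h with h | h <;> simp [h1, h2, fA, fC] at h

/-- The dual diagonal determines its face. -/
theorem eq_of_AC_eq {k k' : Face} (h : s(fA k, fC k) = s(fA k', fC k')) : k = k' := by
  obtain ⟨⟨a, b⟩, e⟩ := k
  obtain ⟨⟨a', b'⟩, e'⟩ := k'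
  rcases Sym2.eq_iff.1 h with ⟨h1, h2⟩ | ⟨h1, h2⟩ <;>
    cases e <;> cases e' <;> simp [fA, fC, Prod.ext_iff] at h1 h2 ⊢ <;> omega

/-- Adjacency of **the leg graph** `Γ τ`: `Λ` together with, for every face `k`, its
`ℤ²`-diagonal `B k D k` if `k ∈ τ` and its dual diagonal `A k C k` otherwise.  (`τ = univ` gives
the route's `G_s`, `τ = ∅` its dual; `prodBernoulli (fun _ ↦ t)` on `τ` is leg L5.) -/
def gammaAdj (τ : Set Face) (u v : V) : Prop :=
  u ≠ v ∧ (lamRel u v ∨ lamRel v u ∨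
    ∃ k : Face, (k ∈ τ ∧ s(u, v) = s(fB k, fD k)) ∨ (k ∉ τ ∧ s(u, v) = s(fA k, fC k)))

/-- `gammaAdj τ` is symmetric. -/
theorem gammaAdj_symm (τ : Set Face) {u v : V} (h : gammaAdj τ u v) : gammaAdj τ v u := by
  refine ⟨h.1.symm, ?_⟩
  have hs : s(v, u) = s(u, v) := Sym2.eq_swap
  rcases h.2 with h2 | h2 | ⟨k, hk⟩
  · exact Or.inr (Or.inl h2)
  · exact Or.inl h2
  · exact Or.inr (Or.inr ⟨k, by rw [hs]; exact hk⟩)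

/-- **The leg graph** `Γ τ` as a simple graph. -/
def Gamma (τ : Set Face) : SimpleGraph V where
  Adj := gammaAdj τ
  symm := ⟨fun _ _ h => gammaAdj_symm τ h⟩
  loopless := ⟨fun _ h => h.1 rfl⟩

/-- Unfolding lemma for the adjacency of `Γ τ`. -/
theorem gamma_adj (τ : Set Face) (u v : V) :
    (Gamma τ).Adj u v ↔ u ≠ v ∧ (lamRel u v ∨ lamRel v u ∨
      ∃ k : Face, (k ∈ τ ∧ s(u, v) = s(fB k, fD k)) ∨ (k ∉ τ ∧ s(u, v) = s(fA k, fC k))) :=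
  Iff.rfl

/-- **Switching the bit of face `k` is the diagonal flip at `k`**: the graph with `k` switched on
is the `flipGraph` (delete `A k C k`, add `B k D k`) of the graph with `k` switched off — the
hypothesis `hflip` of the annealed flip–Russo formula. -/
theorem gamma_insert_eq_flipGraph (τ : Set Face) (k : Face) :
    Gamma (insert k τ) = flipGraph (Gamma (τ \ {k})) (fA k) (fB k) (fC k) (fD k) := by
  ext u v
  rw [flipGraph_adj, gamma_adj, gamma_adj]
  constructor
  · rintro ⟨hne, h⟩
    rcases h with hl | hl | ⟨k', hk'⟩
    · exact Or.inl ⟨⟨hne, Or.inl hl⟩, ne_AC_of_isLeft (Or.inl (isLeft_of_lamRel hl)) k⟩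
    · exact Or.inl ⟨⟨hne, Or.inr (Or.inl hl)⟩, ne_AC_of_isLeft (Or.inr (isLeft_of_lamRel hl)) k⟩
    · rcases hk' with ⟨hmem, heq⟩ | ⟨hnmem, heq⟩
      · by_cases hk : k' = k
        · subst hk
          exact Or.inr ⟨heq.symm, hne⟩
        · have hτ : k' ∈ τ \ {k} := ⟨(Set.mem_insert_iff.1 hmem).resolve_left hk, hk⟩
          refine Or.inl ⟨⟨hne, Or.inr (Or.inr ⟨k', Or.inl ⟨hτ, heq⟩⟩)⟩, ?_⟩
          rw [heq]
          exact ne_AC_of_isLeft (Or.inl rfl) k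
      · have hk : k' ≠ k := fun h => hnmem (h ▸ Set.mem_insert k τ)
        have hτ : k' ∉ τ \ {k} := fun h => hnmem (Set.mem_insert_of_mem k h.1)
        refine Or.inl ⟨⟨hne, Or.inr (Or.inr ⟨k', Or.inr ⟨hτ, heq⟩⟩)⟩, ?_⟩
        rw [heq]
        exact fun h => hk (eq_of_AC_eq h)
  · rintro (⟨⟨hne, h⟩, hneq⟩ | ⟨heq, hne⟩)
    · rcases h with hl | hl | ⟨k', hk'⟩
      · exact ⟨hne, Or.inl hl⟩
      · exact ⟨hne, Or.inr (Or.inl hl)⟩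
      · rcases hk' with ⟨hmem, heq⟩ | ⟨hnmem, heq⟩
        · exact ⟨hne, Or.inr (Or.inr ⟨k', Or.inl ⟨Set.mem_insert_of_mem k hmem.1, heq⟩⟩)⟩
        · by_cases hk : k' = k
          · subst hk
            exact absurd heq hneq
          · have hτ : k' ∉ τ := fun h => hnmem ⟨h, hk⟩
            exact ⟨hne, Or.inr (Or.inr ⟨k', Or.inr
              ⟨fun h => (Set.mem_insert_iff.1 h).elim hk hτ, heq⟩⟩)⟩
    · exact ⟨hne, Or.inr (Or.inr ⟨k, Or.inl ⟨Set.mem_insert k τ, heq.symm⟩⟩)⟩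

/-! ### Mesh, domain and the crude crossing event of the route -/

/-- A radius bounding the (bounded) conformal rectangle. -/
theorem exists_norm_le (R : ConformalRectangle) : ∃ ρ : ℝ, ∀ w ∈ R.carrier, ‖w‖ ≤ ρ := by
  obtain ⟨ρ, hρ⟩ := R.isBounded.subset_closedBall (0 : ℂ)
  exact ⟨ρ, fun w hw => by simpa using hρ hw⟩

/-- Half-width of a box of faces containing every face that meets `R` at mesh `δ`. -/
def boxN (R : ConformalRectangle) (δ : ℝ) : ℕ :=
  ⌈Classical.choose (exists_norm_le R) / δ⌉₊ + 2

/-- The finite set of faces read at mesh `δ` (a box containing all faces meeting the domain; faces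
outside it never touch the crossing event, so their flip responses vanish). -/
def faces (R : ConformalRectangle) (δ : ℝ) : Finset Face :=
  (Finset.Icc (-(boxN R δ : ℤ)) (boxN R δ) ×ˢ Finset.Icc (-(boxN R δ : ℤ)) (boxN R δ)) ×ˢ
    Finset.univ

/-- The leg graph at mesh `δ`: bits outside the box are frozen to "dual diagonal". -/
def GammaMesh (R : ConformalRectangle) (δ : ℝ) (τ : Set Face) : SimpleGraph V :=
  Gamma (τ ∩ ↑(faces R δ))

/-- The route's crude crossing event of `R` at mesh `δ` in the graph `G` (open path with all
vertices in `Ω`, endpoints within `2δ` of the arcs) — verbatim the event of `Target` (ii) /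
`CoveringLeg`, with the graph as a parameter. -/
def crossingEvent (R : ConformalRectangle) (δ : ℝ) (G : SimpleGraph V) : Set (SiteConfig V) :=
  {ω | ∃ u v, Metric.infDist ((δ : ℂ) * z u) (R.arc 0) ≤ 2 * δ ∧
    Metric.infDist ((δ : ℂ) * z v) (R.arc 2) ≤ 2 * δ ∧
    ω ∈ siteConnIn G {y | (δ : ℂ) * z y ∈ R.carrier} u v}

/-- The annealed crossing probability along leg L5: bits `τ ∼ prodBernoulli (fun _ ↦ t)`, fair
colours. -/
def legProb (R : ConformalRectangle) (t δ : ℝ) : ℝ :=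
  ∫ τ, (sitePercolation V half).real (crossingEvent R δ (GammaMesh R δ τ))
    ∂(prodBernoulli fun _ : Face => Set.projIcc 0 1 zero_le_one t)

/-- The annealed flip sum of leg L5 at `(t, δ)`: `Σ_{k ∈ faces R δ} E_t[Δ_k^δ]`, the right-hand
side of the annealed flip–Russo formula. -/
def flipSum (R : ConformalRectangle) (t δ : ℝ) : ℝ :=
  ∑ k ∈ faces R δ, ∫ τ, flipResponse (GammaMesh R δ (τ \ {k})) (fA k) (fB k) (fC k) (fD k)
    (crossingEvent R δ) half ∂(prodBernoulli fun _ : Face => Set.projIcc 0 1 zero_le_one t)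

/-! ### The draft and its consumption -/

/-- **DRAFT typing of the kernel crux on the bits leg L5 (consumed form).**  For every conformal
rectangle the annealed flip sum is small uniformly in the leg parameter:
`∃ η → 0 (δ → 0⁺), ∀ δ ∈ (0,1), ∀ t ∈ [0,1], |flipSum R t δ| ≤ η δ`.
(Mechanism for the docstring of the typed item: four-arm localisation of each `Δ_k`
(`crossing_flipGraph_real_sdiff_eq`), the expansion `E_t[Δ_k] = m_k + r_k` with the spin-2 main
terms cancelling in pairs under the quarter turn about a point of `ℤ²` — a symmetry of the law of
L5 exchanging horizontal- and vertical-diagonal faces (`integral_eq_zero_of_map_eq_of_comp_eq_neg`)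
— and a summable remainder (`abs_sum_le_of_expansion`); the refutable content is the absence of a
colour-flip∘arc-rotation-odd scalar channel above marginality, MC-tested by the lead.) -/
def QuadrupoleSelectionRuleBitsDraft : Prop :=
  ∀ R : ConformalRectangle, ∃ η : ℝ → ℝ, Tendsto η (𝓝[>] 0) (𝓝 0) ∧
    ∀ δ : ℝ, 0 < δ → δ < 1 → ∀ t ∈ Icc (0 : ℝ) 1, |flipSum R t δ| ≤ η δ

/-- `GammaMesh` reads only the bits in the box (hypothesis `hΓ` of the Russo formula). -/
theorem gammaMesh_inter (R : ConformalRectangle) (δ : ℝ) (τ : Set Face) :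
    GammaMesh R δ τ = GammaMesh R δ (τ ∩ ↑(faces R δ)) := by
  simp [GammaMesh, Set.inter_assoc]

/-- Switching a box bit is the diagonal flip (hypothesis `hflip` of the Russo formula). -/
theorem gammaMesh_insert (R : ConformalRectangle) (δ : ℝ) (τ : Set Face) (k : Face)
    (hk : k ∈ faces R δ) :
    GammaMesh R δ (insert k τ) =
      flipGraph (GammaMesh R δ (τ \ {k})) (fA k) (fB k) (fC k) (fD k) := by
  have h1 : insert k τ ∩ ↑(faces R δ) = insert k (τ ∩ ↑(faces R δ)) := by
    ext k'
    simp only [Set.mem_inter_iff, Set.mem_insert_iff, Finset.mem_coe]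
    constructor
    · rintro ⟨rfl | h, h'⟩
      · exact Or.inl rfl
      · exact Or.inr ⟨h, h'⟩
    · rintro (rfl | ⟨h, h'⟩)
      · exact ⟨Or.inl rfl, hk⟩
      · exact ⟨Or.inr h, h'⟩
  have h2 : (τ \ {k}) ∩ ↑(faces R δ) = (τ ∩ ↑(faces R δ)) \ {k} := by
    ext k'
    simp only [Set.mem_inter_iff, Set.mem_sdiff, Set.mem_singleton_iff, Finset.mem_coe]
    tauto
  rw [GammaMesh, GammaMesh, h1, h2]
  exact gamma_insert_eq_flipGraph _ k

/-- **The draft is consumed exactly where the kernel is consumed on L5.**  If the bits-leg draft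
holds, the annealed crossing probabilities of every conformal rectangle are uniformly close along
the whole leg `t ∈ [0, 1]` for small mesh (landed: annealed flip–Russo formula + mean-value step,
`uniform_close_annealed_flipLeg_of_kernel_bound`).  With Cardy's formula at one end of the leg this
gives Cardy's formula at the other by an `ε/2` argument (`tendsto_of_forall_abs_sub_le`,
draft no. 1). -/
theorem legL5_uniform_close_of_draft (h : QuadrupoleSelectionRuleBitsDraft)
    (R : ConformalRectangle) :
    ∀ ε : ℝ, 0 < ε → ∃ δ₀ : ℝ, 0 < δ₀ ∧ ∀ δ : ℝ, 0 < δ → δ < δ₀ →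
      ∀ t ∈ Icc (0 : ℝ) 1, ∀ t' ∈ Icc (0 : ℝ) 1, |legProb R t δ - legProb R t' δ| ≤ ε := by
  classical
  obtain ⟨η, hη, hker⟩ := h R
  exact Summit.CriticalPhenomena.CardyFormulaZ2.Theorems.uniform_close_annealed_flipLeg_of_kernel_bound
    (fun δ => faces R δ) (fun δ τ => GammaMesh R δ τ) (fun δ τ => gammaMesh_inter R δ τ)
    fA fB fC fD (fun δ τ k hk => gammaMesh_insert R δ τ k hk) (fun δ => crossingEvent R δ)
    half η hker hη

end Summit.CriticalPhenomena.CardyFormulaZ2.Cruxes.QuadrupoleSelectionRule.TypingDraftBits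

end
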